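import Summits.CriticalPhenomena.PercolationContinuityZ3.Theorems.Transplant.PathMapCustomers
import Mathlib.Combinatorics.SimpleGraph.Metric
import HarnessLib

/-!
# `p_c < 1` is a ROUGH-ISOMETRY INVARIANT of connected bounded-degree graphs (Lyons–Peres, remark after Thm. 7.15, verbatim) — kernel

builds on p205010 (kernel theorem, internal audit signed; external expert review pending) — nothing in this file uses p205010; unconditional, no node.
Lane `prim-bschramm`, seat `prim-bschramm-p4` gen 24 (PART C3 of `P4-GENERAL.md` §46).  Helper file (`--supports stmt-CriticalPhenomena-4575 --as helper`).

* `IsRoughIsometry G G' φ` — Lyons–Peres' definition (§2.6, (2.20)) with natural-number constants: `α ≥ 1`, `β`, with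
  `dist'(φ x, φ y) ≤ α·dist(x, y) + β`, `dist(x, y) ≤ α·(dist'(φ x, φ y) + β)` (their `α⁻¹ dist − β ≤ dist'`), and every vertex of `G'` within `β` of
  the image.
* **`RoughIso.criticalProb_lt_one_iff`** — for connected locally finite graphs `G`, `G'` with bounded degrees and a rough isometry `φ : G → G'`:
  `p_c(G, x) < 1 ⟺ p_c(G', x') < 1` (any vertices).  Both directions are `GraphPathMap.criticalProb_lt_one_of_lipschitz` (the rough-embedding form of
  Lyons–Peres' domination principle): `φ` has edge-stretch `≤ α + β` and fibres inside balls of radius `αβ`; a rough inverse `ψ` (a `β`-close preimage)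
  has edge-stretch `≤ α(3β+1)` and fibres inside balls of radius `β`.
[cite: LyonsPeres2016, §2.6 (2.20) (rough isometry); §7.4 Thm. 7.15 and the remark following it] [cite: BenjaminiSchramm1996, §2 Conj. 1]
-/

noncomputable section

namespace Summit.CriticalPhenomena.PercolationContinuityZ3.Theorems.Transplant

open SimpleGraph Literature.Probability.Percolation Literature.Probability.LatticeModels Literature.Barriers.CriticalPhenomena
open scoped Classical

/-- **Rough isometry** (Lyons–Peres (2.20), integer constants): `dist'(φx, φy) ≤ α dist(x,y) + β`, `dist(x,y) ≤ α (dist'(φx,φy) + β)`, and the image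
is `β`-dense. [cite: LyonsPeres2016, §2.6 (2.20)] -/
def IsRoughIsometry {V V' : Type} (G : SimpleGraph V) (G' : SimpleGraph V') (φ : V → V') : Prop :=
  ∃ α β : ℕ, 1 ≤ α ∧ (∀ x y, G'.dist (φ x) (φ y) ≤ α * G.dist x y + β) ∧ (∀ x y, G.dist x y ≤ α * (G'.dist (φ x) (φ y) + β)) ∧
    ∀ x' : V', ∃ x : V, G'.dist (φ x) x' ≤ β

namespace RoughIso

variable {V V' : Type} {G : SimpleGraph V} {G' : SimpleGraph V'}

/-- A vertex at distance `≤ n` (connected graph) lies in the ball `B(x, n)`. [folklore] -/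
theorem mem_graphBall_of_dist_le (hc : G.Connected) {x y : V} {n : ℕ} (h : G.dist x y ≤ n) : y ∈ graphBall G x n := by
  obtain ⟨p, hp⟩ := hc.exists_walk_length_eq_dist x y
  exact ⟨p, by rw [hp]; exact h⟩

/-- A set inside a ball of a graph with degrees `≤ D` is finite with at most `(D+1)^n` points. [folklore] -/
theorem finite_ncard_le_of_subset_ball [G.LocallyFinite] {D : ℕ} (hD : ∀ v, G.degree v ≤ D) {s : Set V} {x : V} {n : ℕ}
    (hs : s ⊆ graphBall G x n) : s.Finite ∧ s.ncard ≤ (D + 1) ^ n :=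
  ⟨(graphBall_finite G x n).subset hs, (Set.ncard_le_ncard hs (graphBall_finite G x n)).trans (ballVolume_le_pow_of_degree_le G hD x n)⟩

/-- **Forward transfer**: a rough isometry carries `p_c < 1` from `G` to `G'`. [cite: LyonsPeres2016, §7.4 Thm. 7.15 and the remark following it] -/
theorem criticalProb_lt_one_of_roughIsometry [Countable V] [Countable V'] [G.LocallyFinite] [G'.LocallyFinite] (hc : G.Connected)
    (hc' : G'.Connected) {D D' : ℕ} (hD : ∀ v, G.degree v ≤ D) (hD' : ∀ v, G'.degree v ≤ D') {φ : V → V'} (hφ : IsRoughIsometry G G' φ)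
    (x : V) (hpc : criticalProb G x < 1) (x' : V') : criticalProb G' x' < 1 := by
  obtain ⟨α, β, hα, hup, hlow, -⟩ := hφ
  -- edge-stretch `≤ α + β`
  have hL : ∀ a b, G.Adj a b → ∃ wk : G'.Walk (φ a) (φ b), wk.length ≤ α + β := by
    intro a b hab
    obtain ⟨p, hp⟩ := hc'.exists_walk_length_eq_dist (φ a) (φ b)
    refine ⟨p, ?_⟩
    rw [hp]
    have := hup a b
    rw [dist_eq_one_iff_adj.2 hab, mul_one] at this
    exact this
  -- fibres inside balls of radius `α β`
  have hK : ∀ w, (φ ⁻¹' {w}).Finite ∧ (φ ⁻¹' {w}).ncard ≤ (D + 1) ^ (α * β) := by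
    intro w
    by_cases hw : ∃ a, φ a = w
    · obtain ⟨a, rfl⟩ := hw
      refine finite_ncard_le_of_subset_ball hD (x := a) fun b hb => mem_graphBall_of_dist_le hc ?_
      have hb' : φ b = φ a := hb
      have := hlow a b
      rw [hb', (hc'.dist_eq_zero_iff).2 rfl, zero_add] at this
      exact this
    · rw [show φ ⁻¹' {w} = ∅ from Set.eq_empty_iff_forall_notMem.2 fun a ha => hw ⟨a, ha⟩]
      exact ⟨Set.finite_empty, by rw [Set.ncard_empty]; exact Nat.zero_le _⟩
  have h := GraphPathMap.criticalProb_lt_one_of_lipschitz (H := G) (G := G') φ hL hK hD hD' x hpc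
  rwa [criticalProb_eq_of_reachable G' (hc'.preconnected (φ x) x')] at h

/-- **Backward transfer**: a rough isometry carries `p_c < 1` from `G'` back to `G` (through a `β`-close rough inverse).
[cite: LyonsPeres2016, §7.4 Thm. 7.15 and the remark following it] -/
theorem criticalProb_lt_one_of_roughIsometry_symm [Countable V] [Countable V'] [G.LocallyFinite] [G'.LocallyFinite] (hc : G.Connected)
    (hc' : G'.Connected) {D D' : ℕ} (hD : ∀ v, G.degree v ≤ D) (hD' : ∀ v, G'.degree v ≤ D') {φ : V → V'} (hφ : IsRoughIsometry G G' φ)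
    (x' : V') (hpc : criticalProb G' x' < 1) (x : V) : criticalProb G x < 1 := by
  obtain ⟨α, β, hα, hup, hlow, hdense⟩ := hφ
  choose ψ hψ using hdense
  -- edge-stretch of `ψ`: `dist(ψ a', ψ b') ≤ α (dist'(φψa', φψb') + β) ≤ α (3β + 1)`
  have hL : ∀ a b, G'.Adj a b → ∃ wk : G.Walk (ψ a) (ψ b), wk.length ≤ α * (3 * β + 1) := by
    intro a b hab
    obtain ⟨p, hp⟩ := hc.exists_walk_length_eq_dist (ψ a) (ψ b)
    refine ⟨p, ?_⟩
    rw [hp]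
    have h1 : G'.dist (φ (ψ a)) (φ (ψ b)) ≤ 2 * β + 1 := by
      calc G'.dist (φ (ψ a)) (φ (ψ b)) ≤ G'.dist (φ (ψ a)) a + G'.dist a (φ (ψ b)) := hc'.dist_triangle
        _ ≤ G'.dist (φ (ψ a)) a + (G'.dist a b + G'.dist b (φ (ψ b))) := Nat.add_le_add_left hc'.dist_triangle _
        _ ≤ β + (1 + β) := by
            refine Nat.add_le_add (hψ a) (Nat.add_le_add (dist_eq_one_iff_adj.2 hab).le ?_)
            rw [dist_comm]; exact hψ b
        _ = 2 * β + 1 := by ring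
    calc G.dist (ψ a) (ψ b) ≤ α * (G'.dist (φ (ψ a)) (φ (ψ b)) + β) := hlow _ _
      _ ≤ α * (2 * β + 1 + β) := Nat.mul_le_mul_left α (Nat.add_le_add_right h1 β)
      _ = α * (3 * β + 1) := by ring
  -- fibres of `ψ` inside balls of radius `β` of `G'`
  have hK : ∀ w, (ψ ⁻¹' {w}).Finite ∧ (ψ ⁻¹' {w}).ncard ≤ (D' + 1) ^ β := by
    intro w
    refine finite_ncard_le_of_subset_ball hD' (x := φ w) fun a ha => mem_graphBall_of_dist_le hc' ?_
    have ha' : ψ a = w := ha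
    rw [← ha']; exact hψ a
  have h := GraphPathMap.criticalProb_lt_one_of_lipschitz (H := G') (G := G) ψ hL hK hD' hD x' hpc
  rwa [criticalProb_eq_of_reachable G (hc.preconnected (ψ x') x)] at h

/-- **THEOREM (Lyons–Peres, remark after Thm. 7.15, verbatim): for roughly isometric connected graphs of bounded degree, `p_c(G) < 1 ⟺ p_c(G') < 1`.**
[cite: LyonsPeres2016, §7.4 Thm. 7.15 and the remark following it; §2.6 (2.20)] [cite: BenjaminiSchramm1996, §2 Conj. 1] -/
theorem criticalProb_lt_one_iff [Countable V] [Countable V'] [G.LocallyFinite] [G'.LocallyFinite] (hc : G.Connected) (hc' : G'.Connected)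
    {D D' : ℕ} (hD : ∀ v, G.degree v ≤ D) (hD' : ∀ v, G'.degree v ≤ D') {φ : V → V'} (hφ : IsRoughIsometry G G' φ) (x : V) (x' : V') :
    criticalProb G x < 1 ↔ criticalProb G' x' < 1 :=
  ⟨fun h => criticalProb_lt_one_of_roughIsometry hc hc' hD hD' hφ x h x', fun h => criticalProb_lt_one_of_roughIsometry_symm hc hc' hD hD' hφ x' h x⟩

end RoughIso

end Summit.CriticalPhenomena.PercolationContinuityZ3.Theorems.Transplant

end
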